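import Summits.QuantumFields.BalabanUV.Beta.FP.TorusCompositeFP
import Summits.QuantumFields.BalabanUV.Beta.FP.TorusGeneratorIntertwining

/-!
# `BalabanUV.Beta.FP.TorusCompositeIntertwining` — road «FP» for binder row D1, ROUTE T, the OWNER's SPEC-27 «THE (j, m) TORUS CALL FOR m ≥ 2»:
# **(T-β-4) AT EVERY DEPTH — the PRODUCT RULE and the TIP RULE for the comb tower's generator `towerGen`, with the parameter-transport generator
# `towerC₁(λ)` («multiplication by `λ` in the nested gauge-mode basis») EXPLICIT as the conjugate of `diagonal λ` by the unipotent tower evaluation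
# matrix; hence the composite call's letters `j1 ∕ j2` EXACTLY for the exponential closed forms, `W♯ₖ := Wₖ^{(h+Dλ)}`, `C₂ := (c•C₁)²`** (OFFER O-d1leaf06g20-1)

WHAT.  At depth 1 (`TorusGeneratorIntertwining` p320573, `…Two` p323313) the product rule (★) `diagonal(λ∘base)·W₀ + diagonal(Dλ)·Tip = W₀·C₁(λ)` and the
tip rule `Tip·C₁(λ) = diagonal(λ∘base + Dλ)·Tip` gave the (B) call's `j1 j2` for the field transport `X := −(c • diagonal(λ∘base))`.  Here, for the
m-fold composite (`TorusCompositeObjects`: finest torus `towerTorus Lc M n`, nested modes `towerGen Lc M rs n`, their point evaluation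
`evalN Lc M rs n tip` of `TorusCompositeFP`), BOTH RULES HOLD AT EVERY DEPTH with
`towerC₁ Lc M rs hrs n λ := (towerEvalC …)⁻¹ · diagonal (λ ∘ site ∘ towerEquiv⁻¹) · towerEvalC …` — the matrix of «multiply the gauge function by `λ`»
in the nested basis, read through the unimodular change of basis to the one-shot big comb's point modes (`towerGenIdx_eq`, `evalN_eq`, `det_towerEvalC = 1`
of `TorusCompositeUnimodular` ∕ `TorusCompositeFP`), where both rules are the one-line point identities `productRule_point` ∕ `tipRule_point` (§1, any torus,
any comb).  §3: the letters as GENERIC algebra over the two rules (`j1_of_productRule`, `j2_of_rules` — the depth-1 proofs with the torus data abstracted),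
and the tower instances `torus_j1_tower`, `torus_j2_tower` = the composite call's (`NestedStepLawTorusComposite` §2) binders `j1 j2` at
`W₀ := towerGen`, `C₁ := c • towerC₁ λ`, `C₂ := (c • towerC₁ λ)·(c • towerC₁ λ)`; `uC` there is `TorusGeneratorIntertwining.torus_uC_exp` verbatim (generic
in the parameter type).  NOT here: the dead rows `s1 s2` and `hTW` ((SLICE-m) part 3), leaf-02's (COV-m)(WARD-m)(T-β-m) rows.

HONEST DEPENDENCY (page 1, mandatory): continuum YM on T⁴ ⇐ BetaPertH ∧ nine spine estimates (0/9 proved); BetaPertH ⇐ (D1) ∧ (D4) ∧ CAP+tail;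
G-an2-4 gates asym, D1 and NE2/3/4.  HONEST FRAMING (cell contract, verbatim): «discharging `BetaPertH` makes Bałaban's UV stability UNCONDITIONAL —
a real constructive-QFT result; it is NOT the continuum limit and NOT the Clay problem.»  ABSOLUTE RULE (cell charter, verbatim): «No internally-minted
statement may enter as a cited fact. Every hypothesis is either kernel-proved in this package or a verbatim quotation of a PUBLISHED theorem with page
reference. The manuscript(s) under audit are NOT citable for their own disputed steps — they are the thing under adjudication; programme-internal
(2001/route/tribunal) claims are never citable.»  [our object] bookkeeping + [folklore] linear algebra; no `def … : Prop`, nothing cited, 0 sorry;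
0 estimates; 0∕4 row-D1 binders; NOT (T-ID), NOT SDF, NOT D1, NOT BetaPertH, NOT continuum, NOT Clay.  D1 formalisation swarm LEAF PROVER 06
(b2b-balaban-beta-d1-formalise-leaf-06 gen 20), 2026-08-22.  No existing file touched.
-/

noncomputable section

namespace Summit.QuantumFields.BalabanUV.Beta.FP.TorusCompositeIntertwining

open Matrix
open Literature.MathematicalPhysics.QuantumFieldTheory.Balaban1983to89
open Literature.MathematicalPhysics.QuantumFieldTheory.Balaban1983to89.Beta
open B5Prop11Plancherel (fine)
open B6Lemma24Torus (pbox)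
open AffineAveraging (Site toSite unitVec)
open OneStepResolventKernel (Fib)
open Summit.QuantumFields.BalabanUV.Beta.FP.KernelPeriodisationFib (Idx)
open Summit.QuantumFields.BalabanUV.Beta.FP.TorusGaugeCovariance (tgrad tdelta tgrad_inl)
open Summit.QuantumFields.BalabanUV.Beta.FP.TorusGaugeCovariancePairing (wrapPt wrapPt_of_mem tdelta_eq_ite_wrapPt sum_tdelta_mul)
open Summit.QuantumFields.BalabanUV.Beta.FP.TorusCombRows (Res)
open Summit.QuantumFields.BalabanUV.Beta.FP.TorusGeneratorIntertwining (sum_tgrad_mul_eq)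
open Summit.QuantumFields.BalabanUV.Beta.FP.TorusCompositeObjects
open Summit.QuantumFields.BalabanUV.Beta.FP.TorusCompositeUnimodular
open Summit.QuantumFields.BalabanUV.Beta.FP.TorusCompositeFP (evalN evalN_eq)

variable {d : ℕ}

/-! ## §1 The two point identities: product rule and tip rule for the point modes `δ_x` of ANY comb on ANY torus -/

section Point

variable (N : Fin (d + 1) → ℕ) [∀ μ, NeZero (N μ)] (R : ℕ) (ρ : Site (d + 1))

/-- [folklore] **PRODUCT RULE FOR POINT MODES** (`TorusGeneratorIntertwining.torus_productRule_fine` for any torus and any comb): for the residual point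
modes `δ_x` (`x` a non-root site) and any site function `λ`, `λ(base)·Dδ_x + (Dλ)·[tip = x] = λ(x)·Dδ_x`. -/
theorem productRule_point (lam : ↥(pbox N) → ℝ) :
    Matrix.diagonal (fun b : ↥(pbox N) × Fin (d + 1) => lam b.1)
        * ((tgrad N).submatrix (fun b : ↥(pbox N) × Fin (d + 1) => ((b.1, Sum.inl b.2) : Idx N (Fib d))) (Subtype.val : Res ρ R N → ↥(pbox N))
            : Matrix (↥(pbox N) × Fin (d + 1)) (Res ρ R N) ℝ)
      + Matrix.diagonal (fun b : ↥(pbox N) × Fin (d + 1) => ∑ s, tgrad N (b.1, Sum.inl b.2) s * lam s)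
        * Matrix.of (fun (b : ↥(pbox N) × Fin (d + 1)) (x : Res ρ R N) => tdelta N ((b.1 : Site (d + 1)) + unitVec b.2) x.1)
      = ((tgrad N).submatrix (fun b : ↥(pbox N) × Fin (d + 1) => ((b.1, Sum.inl b.2) : Idx N (Fib d))) (Subtype.val : Res ρ R N → ↥(pbox N))
            : Matrix (↥(pbox N) × Fin (d + 1)) (Res ρ R N) ℝ)
        * Matrix.diagonal (fun x : Res ρ R N => lam x.1) := by
  ext b x
  simp only [Matrix.add_apply, Matrix.diagonal_mul, Matrix.mul_diagonal, Matrix.of_apply, Matrix.submatrix_apply, sum_tgrad_mul_eq]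
  simp only [tgrad_inl, tdelta_eq_ite_wrapPt, wrapPt_of_mem]
  by_cases h1 : wrapPt N ((b.1 : Site (d + 1)) + unitVec b.2) = x.1
  · by_cases h2 : b.1 = x.1
    · rw [if_pos h1, if_pos h2, h1, h2]; ring
    · rw [if_pos h1, if_neg h2, h1]; ring
  · by_cases h2 : b.1 = x.1
    · rw [if_neg h1, if_pos h2, h2]; ring
    · rw [if_neg h1, if_neg h2]; ring

/-- [folklore] **TIP RULE FOR POINT MODES**: `[tip = x]·λ(x) = (λ(base) + Dλ)·[tip = x]` (both read `λ(tip)`). -/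
theorem tipRule_point (lam : ↥(pbox N) → ℝ) :
    Matrix.of (fun (b : ↥(pbox N) × Fin (d + 1)) (x : Res ρ R N) => tdelta N ((b.1 : Site (d + 1)) + unitVec b.2) x.1)
        * Matrix.diagonal (fun x : Res ρ R N => lam x.1)
      = Matrix.diagonal (fun b : ↥(pbox N) × Fin (d + 1) => lam b.1 + ∑ s, tgrad N (b.1, Sum.inl b.2) s * lam s)
        * Matrix.of (fun (b : ↥(pbox N) × Fin (d + 1)) (x : Res ρ R N) => tdelta N ((b.1 : Site (d + 1)) + unitVec b.2) x.1) := by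
  ext b x
  simp only [Matrix.mul_diagonal, Matrix.diagonal_mul, Matrix.of_apply, sum_tgrad_mul_eq, add_sub_cancel, tdelta_eq_ite_wrapPt]
  by_cases h1 : wrapPt N ((b.1 : Site (d + 1)) + unitVec b.2) = x.1
  · rw [if_pos h1, h1]; ring
  · rw [if_neg h1]; ring

end Point

/-! ## §2 The tower: `towerC₁(λ)`, the product rule and the tip rule at every depth -/

section Tower

variable (Lc : ℕ) [NeZero Lc]

/-- [our object — bookkeeping] **THE PARAMETER-TRANSPORT GENERATOR OF THE COMB TOWER**: «multiplication of the gauge function by `λ`» in the nested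
gauge-mode basis `towerGen Lc M rs n` — the diagonal `λ(x)` on the one-shot big comb's point modes, conjugated by the unipotent tower evaluation matrix
`towerEvalC` (`TorusCompositeUnimodular`; `det = 1`).  At depth 1 it is `TorusGeneratorIntertwining`'s block lower-triangular `C₁(λ)` (same matrix,
presented through `evalC`). -/
def towerC₁ (M : Fin (d + 1) → ℕ) [∀ μ, NeZero (M μ)] (rs : ℕ → (Fin (d + 1) → ℕ))
    (hrs : ∀ k i, 0 ≤ toSite (rs k) i ∧ toSite (rs k) i < (Lc : ℤ)) (n : ℕ) (lam : ↥(pbox (towerTorus Lc M n)) → ℝ) :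
    Matrix (NParam Lc M rs n) (NParam Lc M rs n) ℝ :=
  (towerEvalC Lc M rs hrs n)⁻¹
    * Matrix.diagonal (fun u : NParam Lc M rs n => lam ((towerEquiv Lc M rs hrs n).symm u).1)
    * towerEvalC Lc M rs hrs n

/-- [folklore] the tower evaluation matrix is invertible (`det = 1`). -/
theorem isUnit_det_towerEvalC (M : Fin (d + 1) → ℕ) [∀ μ, NeZero (M μ)] (rs : ℕ → (Fin (d + 1) → ℕ))
    (hrs : ∀ k i, 0 ≤ toSite (rs k) i ∧ toSite (rs k) i < (Lc : ℤ)) (n : ℕ) :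
    IsUnit (towerEvalC Lc M rs hrs n).det := by
  rw [det_towerEvalC]; exact isUnit_one

/-- [folklore] the nested modes through the big comb's point modes: `towerGen = (D∣point modes, columns sorted by towerEquiv) · towerEvalC`
(`towerGen_eq_submatrix` + `towerGenIdx_eq`, field slots read). -/
theorem towerGen_eq_point_mul (M : Fin (d + 1) → ℕ) [∀ μ, NeZero (M μ)] (rs : ℕ → (Fin (d + 1) → ℕ))
    (hrs : ∀ k i, 0 ≤ toSite (rs k) i ∧ toSite (rs k) i < (Lc : ℤ)) (n : ℕ) :
    towerGen Lc M rs n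
      = ((tgrad (towerTorus Lc M n)).submatrix
            (fun b : ↥(pbox (towerTorus Lc M n)) × Fin (d + 1) => ((b.1, Sum.inl b.2) : Idx (towerTorus Lc M n) (Fib d)))
            (Subtype.val : Res (bigRoot Lc rs n) (bigRatio Lc n) (towerTorus Lc M n) → ↥(pbox (towerTorus Lc M n)))
            : Matrix (↥(pbox (towerTorus Lc M n)) × Fin (d + 1)) (Res (bigRoot Lc rs n) (bigRatio Lc n) (towerTorus Lc M n)) ℝ).submatrix id
          (towerEquiv Lc M rs hrs n).symm
        * towerEvalC Lc M rs hrs n := by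
  rw [towerGen_eq_submatrix Lc n M rs, towerGenIdx_eq Lc n M rs hrs]
  rfl

/-- [folklore] **THE PRODUCT RULE (★) AT EVERY DEPTH**: for every site function `λ` on the finest torus,
`diagonal(λ∘base) · towerGen + diagonal(Dλ) · evalN(tip) = towerGen · towerC₁(λ)`. -/
theorem towerProductRule (M : Fin (d + 1) → ℕ) [∀ μ, NeZero (M μ)] (rs : ℕ → (Fin (d + 1) → ℕ))
    (hrs : ∀ k i, 0 ≤ toSite (rs k) i ∧ toSite (rs k) i < (Lc : ℤ)) (n : ℕ) (lam : ↥(pbox (towerTorus Lc M n)) → ℝ) :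
    Matrix.diagonal (fun b : ↥(pbox (towerTorus Lc M n)) × Fin (d + 1) => lam b.1) * towerGen Lc M rs n
        + Matrix.diagonal (fun b : ↥(pbox (towerTorus Lc M n)) × Fin (d + 1) => ∑ s, tgrad (towerTorus Lc M n) (b.1, Sum.inl b.2) s * lam s)
          * evalN Lc M rs n (fun b' : ↥(pbox (towerTorus Lc M n)) × Fin (d + 1) => (b'.1 : Site (d + 1)) + unitVec b'.2)
      = towerGen Lc M rs n * towerC₁ Lc M rs hrs n lam := by
  -- names: the sorting, the unipotent matrix, the point modes and the point evaluation (columns sorted), the sorted diagonal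
  set e := towerEquiv Lc M rs hrs n with he
  set C := towerEvalC Lc M rs hrs n with hC
  set Dp := ((tgrad (towerTorus Lc M n)).submatrix
      (fun b : ↥(pbox (towerTorus Lc M n)) × Fin (d + 1) => ((b.1, Sum.inl b.2) : Idx (towerTorus Lc M n) (Fib d)))
      (Subtype.val : Res (bigRoot Lc rs n) (bigRatio Lc n) (towerTorus Lc M n) → ↥(pbox (towerTorus Lc M n)))
      : Matrix (↥(pbox (towerTorus Lc M n)) × Fin (d + 1)) (Res (bigRoot Lc rs n) (bigRatio Lc n) (towerTorus Lc M n)) ℝ).submatrix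
      id e.symm with hDp
  set Tp := (Matrix.of fun (b : ↥(pbox (towerTorus Lc M n)) × Fin (d + 1)) (x : Res (bigRoot Lc rs n) (bigRatio Lc n) (towerTorus Lc M n)) =>
      tdelta (towerTorus Lc M n) ((b.1 : Site (d + 1)) + unitVec b.2) x.1).submatrix id e.symm with hTp
  set Dg := Matrix.diagonal (fun u : NParam Lc M rs n => lam (e.symm u).1) with hDg
  have hG : towerGen Lc M rs n = Dp * C := towerGen_eq_point_mul Lc M rs hrs n
  have hE : evalN Lc M rs n (fun b' : ↥(pbox (towerTorus Lc M n)) × Fin (d + 1) => (b'.1 : Site (d + 1)) + unitVec b'.2) = Tp * C :=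
    evalN_eq Lc _ n M rs hrs
  -- the point product rule, columns sorted by `towerEquiv`
  have hpr : Matrix.diagonal (fun b : ↥(pbox (towerTorus Lc M n)) × Fin (d + 1) => lam b.1) * Dp
      + Matrix.diagonal (fun b : ↥(pbox (towerTorus Lc M n)) × Fin (d + 1) => ∑ s, tgrad (towerTorus Lc M n) (b.1, Sum.inl b.2) s * lam s) * Tp
      = Dp * Dg := by
    have pr := productRule_point (towerTorus Lc M n) (bigRatio Lc n) (bigRoot Lc rs n) lam
    ext b u
    have := congrFun (congrFun pr b) (e.symm u)
    simpa only [Matrix.add_apply, Matrix.diagonal_mul, Matrix.mul_diagonal, Matrix.submatrix_apply, id, hDp, hTp, hDg] using this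
  have hCC : C * (C⁻¹ * Dg * C) = Dg * C := by
    rw [← Matrix.mul_assoc, ← Matrix.mul_assoc, Matrix.mul_nonsing_inv _ (isUnit_det_towerEvalC Lc M rs hrs n), Matrix.one_mul]
  rw [hG, hE, towerC₁, ← hC, ← he, ← hDg, ← Matrix.mul_assoc, ← Matrix.mul_assoc, ← Matrix.add_mul, hpr, Matrix.mul_assoc Dp C, hCC,
    Matrix.mul_assoc]

/-- [folklore] **THE TIP RULE AT EVERY DEPTH**: `evalN(tip) · towerC₁(λ) = diagonal(λ∘base + Dλ) · evalN(tip)`. -/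
theorem towerTipRule (M : Fin (d + 1) → ℕ) [∀ μ, NeZero (M μ)] (rs : ℕ → (Fin (d + 1) → ℕ))
    (hrs : ∀ k i, 0 ≤ toSite (rs k) i ∧ toSite (rs k) i < (Lc : ℤ)) (n : ℕ) (lam : ↥(pbox (towerTorus Lc M n)) → ℝ) :
    evalN Lc M rs n (fun b' : ↥(pbox (towerTorus Lc M n)) × Fin (d + 1) => (b'.1 : Site (d + 1)) + unitVec b'.2) * towerC₁ Lc M rs hrs n lam
      = Matrix.diagonal (fun b : ↥(pbox (towerTorus Lc M n)) × Fin (d + 1) =>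
            lam b.1 + ∑ s, tgrad (towerTorus Lc M n) (b.1, Sum.inl b.2) s * lam s)
        * evalN Lc M rs n (fun b' : ↥(pbox (towerTorus Lc M n)) × Fin (d + 1) => (b'.1 : Site (d + 1)) + unitVec b'.2) := by
  set e := towerEquiv Lc M rs hrs n with he
  set C := towerEvalC Lc M rs hrs n with hC
  set Tp := (Matrix.of fun (b : ↥(pbox (towerTorus Lc M n)) × Fin (d + 1)) (x : Res (bigRoot Lc rs n) (bigRatio Lc n) (towerTorus Lc M n)) =>
      tdelta (towerTorus Lc M n) ((b.1 : Site (d + 1)) + unitVec b.2) x.1).submatrix id e.symm with hTp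
  set Dg := Matrix.diagonal (fun u : NParam Lc M rs n => lam (e.symm u).1) with hDg
  have hE : evalN Lc M rs n (fun b' : ↥(pbox (towerTorus Lc M n)) × Fin (d + 1) => (b'.1 : Site (d + 1)) + unitVec b'.2) = Tp * C :=
    evalN_eq Lc _ n M rs hrs
  have htr : Tp * Dg = Matrix.diagonal (fun b : ↥(pbox (towerTorus Lc M n)) × Fin (d + 1) =>
      lam b.1 + ∑ s, tgrad (towerTorus Lc M n) (b.1, Sum.inl b.2) s * lam s) * Tp := by
    have tr := tipRule_point (towerTorus Lc M n) (bigRatio Lc n) (bigRoot Lc rs n) lam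
    ext b u
    have := congrFun (congrFun tr b) (e.symm u)
    simpa only [Matrix.diagonal_mul, Matrix.mul_diagonal, Matrix.submatrix_apply, id, hTp, hDg] using this
  have hCC : C * (C⁻¹ * Dg * C) = Dg * C := by
    rw [← Matrix.mul_assoc, ← Matrix.mul_assoc, Matrix.mul_nonsing_inv _ (isUnit_det_towerEvalC Lc M rs hrs n), Matrix.one_mul]
  rw [hE, towerC₁, ← hC, ← he, ← hDg, Matrix.mul_assoc Tp C, hCC, ← Matrix.mul_assoc, htr, Matrix.mul_assoc]

end Tower

/-! ## §3 The letters `j1 ∕ j2` as generic algebra over the two rules, and their tower instances -/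

section Letters

variable {β σ : Type*} [Fintype β] [Fintype σ] [DecidableEq β]

/-- [folklore] **`j1` FROM THE PRODUCT RULE** (the depth-1 `torus_j1` with the torus data abstracted): if `diagonal λb·W₀ + diagonal Δ·T = W₀·C₁` then for
`X := −(c • diagonal λb)`, `W₁ := of (−c·h·T)`, `W♯₁ := of (−c·(h + Δ)·T)`: `−X·W₀ + W₁ = W♯₁ + W₀·(c•C₁)`. -/
theorem j1_of_productRule (lamb dlam h : β → ℝ) (c : ℝ) (W₀ T : Matrix β σ ℝ) (C₁ : Matrix σ σ ℝ)
    (key : Matrix.diagonal lamb * W₀ + Matrix.diagonal dlam * T = W₀ * C₁)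
    {X : Matrix β β ℝ} (hX : X = -(c • Matrix.diagonal lamb))
    {W₁ W₁' : Matrix β σ ℝ} (hW₁ : W₁ = Matrix.of fun (b : β) (e : σ) => -(c * h b * T b e))
    (hW₁' : W₁' = Matrix.of fun (b : β) (e : σ) => -(c * (h b + dlam b) * T b e)) :
    -X * W₀ + W₁ = W₁' + W₀ * (c • C₁) := by
  have hsplit : W₁' = W₁ + -(c • (Matrix.diagonal dlam * T)) := by
    rw [hW₁, hW₁']
    ext b e
    simp only [Matrix.add_apply, Matrix.neg_apply, Matrix.smul_apply, Matrix.diagonal_mul, Matrix.of_apply, smul_eq_mul]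
    ring
  rw [hsplit, hX, neg_neg, Matrix.smul_mul, Matrix.mul_smul, ← key, smul_add]
  abel

/-- [folklore] **`j2` FROM THE PRODUCT RULE AND THE TIP RULE** (the depth-1 `torus_j2` abstracted): with `key1` as in `j1_of_productRule`,
`key2 : T·C₁ = diagonal(λb + Δ)·T`, and the exponential closed forms `W₂ := of ((c·h)²·T)`, `W♯₂ := of ((c·(h+Δ))²·T)`:
`X·X·W₀ + 2•(−X·W₁) + W₂ = W♯₂ + 2•(W♯₁·(c•C₁)) + W₀·(c•C₁·(c•C₁))`. -/
theorem j2_of_rules (lamb dlam h : β → ℝ) (c : ℝ) (W₀ T : Matrix β σ ℝ) (C₁ : Matrix σ σ ℝ)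
    (key1 : Matrix.diagonal lamb * W₀ + Matrix.diagonal dlam * T = W₀ * C₁)
    (key2 : T * C₁ = Matrix.diagonal (fun b : β => lamb b + dlam b) * T)
    {X : Matrix β β ℝ} (hX : X = -(c • Matrix.diagonal lamb))
    {W₁ W₁' W₂ W₂' : Matrix β σ ℝ} (hW₁ : W₁ = Matrix.of fun (b : β) (e : σ) => -(c * h b * T b e))
    (hW₁' : W₁' = Matrix.of fun (b : β) (e : σ) => -(c * (h b + dlam b) * T b e))
    (hW₂ : W₂ = Matrix.of fun (b : β) (e : σ) => (c * h b) ^ 2 * T b e)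
    (hW₂' : W₂' = Matrix.of fun (b : β) (e : σ) => (c * (h b + dlam b)) ^ 2 * T b e) :
    X * X * W₀ + (2 : ℝ) • (-X * W₁) + W₂ = W₂' + (2 : ℝ) • (W₁' * (c • C₁)) + W₀ * (c • C₁ * (c • C₁)) := by
  set Λb : Matrix β β ℝ := Matrix.diagonal lamb with hΛb
  set Δ : Matrix β β ℝ := Matrix.diagonal dlam with hΔ
  set Λt : Matrix β β ℝ := Matrix.diagonal (fun b : β => lamb b + dlam b) with hΛt
  set Hd : Matrix β β ℝ := Matrix.diagonal h with hHd
  set Θ : Matrix β β ℝ := Matrix.diagonal (fun b : β => h b + dlam b) with hΘ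
  have hWCC : W₀ * (C₁ * C₁) = Λb * (Λb * W₀ + Δ * T) + Δ * (Λt * T) := by
    rw [← Matrix.mul_assoc, ← key1, Matrix.add_mul, Matrix.mul_assoc, ← key1, Matrix.mul_assoc, key2]
  have eW₁ : W₁ = -(c • (Hd * T)) := by
    rw [hW₁]; ext b e
    simp only [Matrix.neg_apply, Matrix.smul_apply, Matrix.diagonal_mul, Matrix.of_apply, smul_eq_mul, hHd]; ring
  have eW₁' : W₁' = -(c • (Θ * T)) := by
    rw [hW₁']; ext b e
    simp only [Matrix.neg_apply, Matrix.smul_apply, Matrix.diagonal_mul, Matrix.of_apply, smul_eq_mul, hΘ]; ring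
  have eW₂ : W₂ = (c * c) • (Hd * (Hd * T)) := by
    rw [hW₂]; ext b e
    simp only [Matrix.smul_apply, Matrix.diagonal_mul, Matrix.of_apply, smul_eq_mul, hHd]; ring
  have eW₂' : W₂' = (c * c) • (Θ * (Θ * T)) := by
    rw [hW₂']; ext b e
    simp only [Matrix.smul_apply, Matrix.diagonal_mul, Matrix.of_apply, smul_eq_mul, hΘ]; ring
  rw [eW₂, eW₂', eW₁, eW₁', hX]
  simp only [neg_neg, neg_mul_neg, Matrix.mul_neg, Matrix.neg_mul, Matrix.smul_mul, Matrix.mul_smul, smul_smul, smul_neg,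
    Matrix.mul_assoc, key2, hWCC]
  ext b e
  simp only [Matrix.add_apply, Matrix.neg_apply, Matrix.smul_apply, Matrix.diagonal_mul, Matrix.mul_add, smul_eq_mul, hΛb, hΔ, hΛt,
    hHd, hΘ]
  ring

variable (Lc : ℕ) [NeZero Lc]

/-- [folklore] **`j1` OF THE COMPOSITE CALL AT EVERY DEPTH** (`NestedStepLawTorusComposite` §2's binder, `W₀ := towerGen`, `C₁ := c • towerC₁ λ`): field
transport `X := −(c • diagonal(λ∘base))` on the finest torus, the nested chart's generator first jet in the exponential closed form
`W₁ = of (−c·h b·evalN tip b e)` and the one-shot chart's `W♯₁ = of (−c·(h b + (Dλ) b)·evalN tip b e)`. -/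
theorem torus_j1_tower (M : Fin (d + 1) → ℕ) [∀ μ, NeZero (M μ)] (rs : ℕ → (Fin (d + 1) → ℕ))
    (hrs : ∀ k i, 0 ≤ toSite (rs k) i ∧ toSite (rs k) i < (Lc : ℤ)) (n : ℕ) (lam : ↥(pbox (towerTorus Lc M n)) → ℝ) (c : ℝ)
    (h : ↥(pbox (towerTorus Lc M n)) × Fin (d + 1) → ℝ)
    {X : Matrix (↥(pbox (towerTorus Lc M n)) × Fin (d + 1)) (↥(pbox (towerTorus Lc M n)) × Fin (d + 1)) ℝ}
    (hX : X = -(c • Matrix.diagonal (fun b : ↥(pbox (towerTorus Lc M n)) × Fin (d + 1) => lam b.1)))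
    {W₁ W₁' : Matrix (↥(pbox (towerTorus Lc M n)) × Fin (d + 1)) (NParam Lc M rs n) ℝ}
    (hW₁ : W₁ = Matrix.of fun (b : ↥(pbox (towerTorus Lc M n)) × Fin (d + 1)) (e : NParam Lc M rs n) =>
        -(c * h b * evalN Lc M rs n (fun b' : ↥(pbox (towerTorus Lc M n)) × Fin (d + 1) => (b'.1 : Site (d + 1)) + unitVec b'.2) b e))
    (hW₁' : W₁' = Matrix.of fun (b : ↥(pbox (towerTorus Lc M n)) × Fin (d + 1)) (e : NParam Lc M rs n) =>
        -(c * (h b + ∑ s, tgrad (towerTorus Lc M n) (b.1, Sum.inl b.2) s * lam s)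
          * evalN Lc M rs n (fun b' : ↥(pbox (towerTorus Lc M n)) × Fin (d + 1) => (b'.1 : Site (d + 1)) + unitVec b'.2) b e)) :
    -X * towerGen Lc M rs n + W₁ = W₁' + towerGen Lc M rs n * (c • towerC₁ Lc M rs hrs n lam) :=
  j1_of_productRule _ _ h c _ _ _ (towerProductRule Lc M rs hrs n lam) hX hW₁ hW₁'

/-- [folklore] **`j2` OF THE COMPOSITE CALL AT EVERY DEPTH** (`C₂ := (c • towerC₁ λ)·(c • towerC₁ λ)`), for the exponential closed forms
`W₂ = of ((c·h b)²·evalN tip b e)`, `W♯₂ = of ((c·(h b + (Dλ) b))²·evalN tip b e)`. -/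
theorem torus_j2_tower (M : Fin (d + 1) → ℕ) [∀ μ, NeZero (M μ)] (rs : ℕ → (Fin (d + 1) → ℕ))
    (hrs : ∀ k i, 0 ≤ toSite (rs k) i ∧ toSite (rs k) i < (Lc : ℤ)) (n : ℕ) (lam : ↥(pbox (towerTorus Lc M n)) → ℝ) (c : ℝ)
    (h : ↥(pbox (towerTorus Lc M n)) × Fin (d + 1) → ℝ)
    {X : Matrix (↥(pbox (towerTorus Lc M n)) × Fin (d + 1)) (↥(pbox (towerTorus Lc M n)) × Fin (d + 1)) ℝ}
    (hX : X = -(c • Matrix.diagonal (fun b : ↥(pbox (towerTorus Lc M n)) × Fin (d + 1) => lam b.1)))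
    {W₁ W₁' W₂ W₂' : Matrix (↥(pbox (towerTorus Lc M n)) × Fin (d + 1)) (NParam Lc M rs n) ℝ}
    (hW₁ : W₁ = Matrix.of fun (b : ↥(pbox (towerTorus Lc M n)) × Fin (d + 1)) (e : NParam Lc M rs n) =>
        -(c * h b * evalN Lc M rs n (fun b' : ↥(pbox (towerTorus Lc M n)) × Fin (d + 1) => (b'.1 : Site (d + 1)) + unitVec b'.2) b e))
    (hW₁' : W₁' = Matrix.of fun (b : ↥(pbox (towerTorus Lc M n)) × Fin (d + 1)) (e : NParam Lc M rs n) =>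
        -(c * (h b + ∑ s, tgrad (towerTorus Lc M n) (b.1, Sum.inl b.2) s * lam s)
          * evalN Lc M rs n (fun b' : ↥(pbox (towerTorus Lc M n)) × Fin (d + 1) => (b'.1 : Site (d + 1)) + unitVec b'.2) b e))
    (hW₂ : W₂ = Matrix.of fun (b : ↥(pbox (towerTorus Lc M n)) × Fin (d + 1)) (e : NParam Lc M rs n) =>
        (c * h b) ^ 2 * evalN Lc M rs n (fun b' : ↥(pbox (towerTorus Lc M n)) × Fin (d + 1) => (b'.1 : Site (d + 1)) + unitVec b'.2) b e)
    (hW₂' : W₂' = Matrix.of fun (b : ↥(pbox (towerTorus Lc M n)) × Fin (d + 1)) (e : NParam Lc M rs n) =>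
        (c * (h b + ∑ s, tgrad (towerTorus Lc M n) (b.1, Sum.inl b.2) s * lam s)) ^ 2
          * evalN Lc M rs n (fun b' : ↥(pbox (towerTorus Lc M n)) × Fin (d + 1) => (b'.1 : Site (d + 1)) + unitVec b'.2) b e) :
    X * X * towerGen Lc M rs n + (2 : ℝ) • (-X * W₁) + W₂
      = W₂' + (2 : ℝ) • (W₁' * (c • towerC₁ Lc M rs hrs n lam)) + towerGen Lc M rs n * (c • towerC₁ Lc M rs hrs n lam * (c • towerC₁ Lc M rs hrs n lam)) :=
  j2_of_rules _ _ h c _ _ _ (towerProductRule Lc M rs hrs n lam) (towerTipRule Lc M rs hrs n lam) hX hW₁ hW₁' hW₂ hW₂'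

end Letters

end Summit.QuantumFields.BalabanUV.Beta.FP.TorusCompositeIntertwining

end
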